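import Summits.CriticalPhenomena.PercolationContinuityZ3.Theorems.Transplant.FKConnectivityAllQClusterAssocFiber
import Summits.CriticalPhenomena.PercolationContinuityZ3.Theorems.Transplant.FKConnectivityAllQDoubleConeTransfer
import HarnessLib

/-!
# Connectivity correlation inequalities for `φ_{w,q}` — CA (`ClusterAssocFKPos`) FAILS for `q < 1`: the cluster of a vertex is
# NOT positively associated; refutation by an exact transfer computation on the double cone `K_{2,34}` at `q = 1/4`, `p = 1/3`

Support file (`--supports stmt-CriticalPhenomena-4575`), census seat `prim-bschramm-census` (gen 21) of the post-continuity
programme; builds on p205010 (kernel theorem, internal audit signed; external expert review pending).  Definitions: the weight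
rational transfer recursion `ZM`/`Nr` and the witness sets `pThird`, `leaves`, `halfR`, `halfR'` (certificate data; the
weight vector `DoubleCone.wK` and the transfer identities are in `…AllQDoubleConeTransfer.lean`); no named facts, no sorries; standard axioms (`decide`, no `native_decide`).

FINDING (census gens 20–21; memos bschramm/FROM-census-g20-MM-REFUTED.md §(ii), FROM-census-g21-CA-PAIRS.md).  fk-1 g7's node CA —
"for every `q > 0`, every finite weighted graph, every vertex `x` and all up-sets `𝒰, 𝒱` of vertex sets,
`φ(C_x ∈ 𝒰)·φ(C_x ∈ 𝒱) ≤ φ(C_x ∈ 𝒰 ∩ 𝒱)`" — is FALSE, but only on large graphs: the exhaustive all-pairs census finds no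
violation on any rooted graph with `≤ 7` vertices (gen 21), while on the double cone `K_{2,m}` (hubs `u = x` and `v`, `m` leaves,
all `2m` edges of parameter `p`) the principal up-sets `𝒰 = {S ⊇ R ∪ {v}}`, `𝒱 = {S ⊇ R' ∪ {v}}` (`R ⊔ R'` the leaves, balanced)
violate CA as soon as, roughly, `(1 − ρ^{m/2})² > q` with `ρ = 1 − qv²/((2v+v²)(q+2v))`, `v = p/(1−p)` — first at `m = 34`
(`n = 36`) for `q = 1/4`, `p = 1/3`: `φ(𝒰) = φ(𝒱) = 0.0450962096…`, `φ(𝒰)φ(𝒱) − φ(𝒰 ∩ 𝒱) = 2.236·10⁻⁹ > 0`.  MECHANISM: given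
`u ↔ v` the leaf states form a product measure CONDITIONED on "some leaf carries both its edges", under which the non-isolation of
disjoint leaf sets is slightly negatively correlated; the competing positive mixture term is `φ(u ↮ v) = O(q·((q+2v)/(q+2v+v²))^m)`.

THE PROOF is a transfer-matrix computation carried out inside the measure library, with NO enumeration: for the weight vector
`wK u v p L` (parameter `p` on `s(u,ℓ), s(ℓ,v)` for `ℓ ∈ L`, `0` elsewhere) write `Z(L)`, `M(L) = S(u ↔ v)` and
`N(R, L) = S(u ↔ v, every ℓ ∈ R has an open edge)`.  Every leaf is an APEX over the hubs, so fk-1 g5's apex identities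
(`apex_mass`, `apex_mass_ab_inter`, file `…AllQApexMass`) give the 2×2 recursion
`Z(L) = α²Z(L−ℓ) − βM(L−ℓ)`, `M(L) = (α² − β − γ)M(L−ℓ) + γZ(L−ℓ)` (`α = 1−p+p/q`, `β = p²q⁻¹(q⁻¹−1)`, `γ = p²q⁻²`), the
closed-pair split (`sum_rcWeightW_ind_compl_openPair_inter`, fk-3) gives `N(R ∪ {ℓ}, L) = N(R, L) − (1−p)²N(R, L−ℓ)`, and almost
surely `{C_u ⊇ R ∪ {v}} = {u ↔ v} ∩ ⋂_{ℓ ∈ R} (J_{uℓ} ∪ J_{ℓv})` (`reachable_ux_apex_iff`).  Hence `Z, M, N` depend only on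
`|L|, |R|` and equal the rational recursion `ZM`/`Nr` (inclusion–exclusion form), whose three values at `(36; 34; 17)` are compared
by `decide` (kernel): `N(17,34)² > N(34,34)·Z(34)`.
* `FK.ClusterAssocCex.not_clusterAssocOn_fin36 : ¬ ClusterAssocOn (Fin 36) (1/4)`;
* **`FK.not_clusterAssocFKPos : ¬ ClusterAssocFKPos`** — so in fk-1 g7's chain MM ⇒ CA ⇒ Hub the first two nodes are refuted in the
  kernel (MM: `FK.not_clusterDomAdjFKPos`, census gen 20); the hub inequality / ALR Conj. 7.1 is not touched (it holds on every double
  cone, closed form; clean in every census).  CA stays a theorem for `q ≥ 1` (`clusterAssocOn_of_one_le`);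
* `FK.not_clusterPairCountAll : ¬ ClusterPairCountAll` — fk-1 g7's `q`-free counting form RB of CA (TRUE on `≤ 7` vertices by the
  exhaustive census of gen 18) is false as filed, via `clusterAssocFKPos_of_clusterPairCountAll`.
[cite: Grimmett2006, §1.4 eq. (1.20) (p. 15); Thm. (3.8) (p. 39); §3.9 (p. 63)] [cite: AyyerLinussonRavichandran2025, §7 eq. (13), Conj. 7.1 (p. 22)]
-/

noncomputable section

namespace Summit.CriticalPhenomena.PercolationContinuityZ3.Theorems

namespace FK

open MeasureTheory Set Literature.Probability.LatticeModels Literature.Probability.Percolation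
open Literature.Probability.Percolation.DecisionTree (ind ind_of_mem ind_of_not_mem)
open scoped Classical symmDiff

open DoubleCone

namespace ClusterAssocCex
/-! ### The certificate data: the rational transfer recursion -/

/-- `(Z_l, M_l)`: partition function and `u ↔ v` mass of the double cone with `l` live leaves inside `n₀` vertices; one leaf is
the transfer step `(Z, M) ↦ (α²Z − βM, (α² − β − γ)M + γZ)` with `α = 1−p+p/q`, `β = p²q⁻¹(q⁻¹−1)`, `γ = p²q⁻²`.
[cite: Grimmett2006, §1.4 eq. (1.20) (p. 15)] -/
def ZM (p q : ℚ) (n₀ : ℕ) : ℕ → ℚ × ℚ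
  | 0 => (q ^ n₀, 0)
  | l + 1 =>
    let z := ZM p q n₀ l
    (((1 - p) + p / q) ^ 2 * z.1 - p ^ 2 / q * (1 / q - 1) * z.2,
      (((1 - p) + p / q) ^ 2 - p ^ 2 / q * (1 / q - 1) - p ^ 2 / q ^ 2) * z.2 + p ^ 2 / q ^ 2 * z.1)

/-- `N(r, l) = ∑_t (−1)^t C(r,t) (1−p)^{2t} M_{l−t}`: the mass of `{u ↔ v, r given leaves not isolated}` (inclusion–exclusion form).
[cite: Grimmett2006, §1.4 eq. (1.20) (p. 15)] -/
def Nr (p q : ℚ) (n₀ r l : ℕ) : ℚ :=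
  ∑ t ∈ Finset.range (r + 1), (-1) ^ t * (r.choose t : ℚ) * ((1 - p) ^ 2) ^ t * (ZM p q n₀ (l - t)).2

/-- `N(0, l) = M_l`. [folklore] -/
theorem Nr_zero (p q : ℚ) (n₀ l : ℕ) : Nr p q n₀ 0 l = (ZM p q n₀ l).2 := by
  simp [Nr]

/-- Pascal's rule for the inclusion–exclusion form: `N(r+1, l) = N(r, l) − (1−p)² N(r, l−1)`. [folklore] -/
theorem Nr_succ (p q : ℚ) (n₀ r l : ℕ) : Nr p q n₀ (r + 1) l = Nr p q n₀ r l - (1 - p) ^ 2 * Nr p q n₀ r (l - 1) := by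
  set c : ℚ := (1 - p) ^ 2 with hc
  set f : ℕ → ℚ := fun t => (-1) ^ t * c ^ t * (ZM p q n₀ (l - t)).2 with hf
  have hN : ∀ r' l', Nr p q n₀ r' l' =
      ∑ t ∈ Finset.range (r' + 1), (r'.choose t : ℚ) * ((-1) ^ t * c ^ t * (ZM p q n₀ (l' - t)).2) := by
    intro r' l'; unfold Nr; exact Finset.sum_congr rfl fun t _ => by ring
  have h1 : Nr p q n₀ (r + 1) l = f 0 + ∑ t ∈ Finset.range (r + 1), ((r + 1).choose (t + 1) : ℚ) * f (t + 1) := by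
    rw [hN, Finset.sum_range_succ' _ (r + 1)]
    simp only [Nat.choose_zero_right, Nat.cast_one, one_mul, hf]
    ring
  have h2 : ∑ t ∈ Finset.range (r + 1), ((r + 1).choose (t + 1) : ℚ) * f (t + 1) =
      ∑ t ∈ Finset.range (r + 1), (r.choose t : ℚ) * f (t + 1) +
        ∑ t ∈ Finset.range (r + 1), (r.choose (t + 1) : ℚ) * f (t + 1) := by
    rw [← Finset.sum_add_distrib]
    refine Finset.sum_congr rfl fun t _ => ?_
    rw [Nat.choose_succ_succ', Nat.cast_add]; ring
  have h3 : f 0 + ∑ t ∈ Finset.range (r + 1), (r.choose (t + 1) : ℚ) * f (t + 1) = Nr p q n₀ r l := by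
    have h4 : ∑ t ∈ Finset.range (r + 2), (r.choose t : ℚ) * f t = Nr p q n₀ r l := by
      rw [Finset.sum_range_succ, Nat.choose_succ_self, Nat.cast_zero, zero_mul, add_zero, hN]
    rw [← h4, Finset.sum_range_succ' _ (r + 1)]
    simp only [Nat.choose_zero_right, Nat.cast_one, one_mul]
    ring
  have h5 : ∑ t ∈ Finset.range (r + 1), (r.choose t : ℚ) * f (t + 1) = -(c * Nr p q n₀ r (l - 1)) := by
    rw [hN, Finset.mul_sum, ← Finset.sum_neg_distrib]
    refine Finset.sum_congr rfl fun t _ => ?_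
    have hl : l - (t + 1) = l - 1 - t := by omega
    simp only [hf, hl, pow_succ]
    ring
  rw [h1, h2, ← add_assoc, add_right_comm, h3, h5]
  ring

/-- THE NUMERICAL CERTIFICATE (`q = 1/4`, `p = 1/3`, `36` vertices, `34` leaves, `|R| = |R'| = 17`):
`N(34,34)·Z(34) < N(17,34)²`, i.e. `φ(𝒰 ∩ 𝒱) < φ(𝒰)φ(𝒱)`. [cite: Grimmett2006, §1.4 eq. (1.20) (p. 15)] -/
theorem certificate :
    Nr (1 / 3) (1 / 4) 36 34 34 * (ZM (1 / 3) (1 / 4) 36 34).1 < Nr (1 / 3) (1 / 4) 36 17 34 * Nr (1 / 3) (1 / 4) 36 17 34 := by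
  decide +kernel

variable {V : Type*} [Fintype V]

/-! ### The masses as functions of the cardinalities -/

section Values

variable (u v : V) (p : unitInterval) (q : ℝ) (pq qq : ℚ)

/-- `Z(L) = Z_{|L|}` and `M(L) = M_{|L|}` (the rational recursion `ZM`). [cite: Grimmett2006, §1.4 eq. (1.20) (p. 15)] -/
theorem ZM_eq (hq : q ≠ 0) (hqq : q = (qq : ℝ)) (hpq : ((p : unitInterval) : ℝ) = (pq : ℝ)) (huv : u ≠ v) :
    ∀ L : Finset V, (∀ ℓ ∈ L, ℓ ≠ u ∧ ℓ ≠ v) →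
      rcPartitionFunctionW (wK u v p L) q ∅ = ((ZM pq qq (Fintype.card V) L.card).1 : ℝ) ∧
        ∑ ω : BondConfig V, rcWeightW (wK u v p L) q ∅ ω * ind (openConn u v : Set (BondConfig V)) ω =
          ((ZM pq qq (Fintype.card V) L.card).2 : ℝ) := by
  intro L
  induction L using Finset.induction_on with
  | empty =>
    intro _
    rw [Finset.card_empty, Z_empty, M_empty u v p q huv, hqq]
    simp [ZM]
  | @insert ℓ L hℓ ih =>
    intro hL
    have hL' : ∀ ℓ' ∈ L, ℓ' ≠ u ∧ ℓ' ≠ v := fun ℓ' h => hL ℓ' (Finset.mem_insert_of_mem h)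
    have hℓuv := hL ℓ (Finset.mem_insert_self ℓ L)
    obtain ⟨ihZ, ihM⟩ := ih hL'
    rw [Finset.card_insert_of_notMem hℓ, Z_insert u v p q hq hL' huv hℓuv.1 hℓuv.2 hℓ,
      M_insert u v p q hq hL' huv hℓuv.1 hℓuv.2 hℓ, ihZ, ihM, hpq, hqq]
    simp only [ZM]
    push_cast
    constructor <;> ring

/-- `N(R, L) = N_{|R|,|L|}` (the rational recursion `Nr`) for `R ⊆ L`. [cite: Grimmett2006, §1.4 eq. (1.20) (p. 15)] -/
theorem N_eq (hq : q ≠ 0) (hqq : q = (qq : ℝ)) (hpq : ((p : unitInterval) : ℝ) = (pq : ℝ)) (huv : u ≠ v) :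
    ∀ R L : Finset V, (∀ ℓ ∈ L, ℓ ≠ u ∧ ℓ ≠ v) → R ⊆ L →
      ∑ ω : BondConfig V, rcWeightW (wK u v p L) q ∅ ω * ind (ev u v R) ω =
        ((Nr pq qq (Fintype.card V) R.card L.card : ℚ) : ℝ) := by
  intro R
  induction R using Finset.induction_on with
  | empty =>
    intro L hL _
    have hev : ev u v (∅ : Finset V) = (openConn u v : Set (BondConfig V)) := by
      ext ω; simp [ev]
    rw [hev, (ZM_eq u v p q pq qq hq hqq hpq huv L hL).2, Finset.card_empty, Nr_zero]
  | @insert ℓ R hℓR ih =>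
    intro L hL hRL
    have hℓL : ℓ ∈ L := hRL (Finset.mem_insert_self ℓ R)
    have hℓuv := hL ℓ hℓL
    set L' := L.erase ℓ with hL'def
    have hLeq : L = insert ℓ L' := (Finset.insert_erase hℓL).symm
    have hℓL' : ℓ ∉ L' := Finset.notMem_erase ℓ L
    have hL'h : ∀ ℓ' ∈ L', ℓ' ≠ u ∧ ℓ' ≠ v := fun ℓ' h => hL ℓ' (Finset.mem_of_mem_erase h)
    have hRL' : R ⊆ L' := by
      intro x hx
      exact Finset.mem_erase.2 ⟨fun h => hℓR (h ▸ hx), hRL (Finset.mem_insert_of_mem hx)⟩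
    have hcard : L.card = L'.card + 1 := by rw [hLeq, Finset.card_insert_of_notMem hℓL']
    rw [hLeq, N_insert u v p q hL'h huv hℓuv.1 hℓuv.2 hℓL' R, ← hLeq, ih L hL (hRL'.trans (Finset.erase_subset ℓ L)),
      ih L' hL'h hRL', Finset.card_insert_of_notMem hℓR, hcard, Nr_succ, Nat.add_sub_cancel, hpq]
    push_cast
    ring

end Values
/-! ### The cluster event almost surely -/

/-- Almost surely under `wK u v p L`: `C_u ⊇ R ∪ {v}` iff `u ↔ v` and every leaf of `R ⊆ L` carries an open pair.
[cite: Grimmett2006, §1.4 eq. (1.20) (p. 15)] -/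
theorem clusterIn_iff_ev (u v : V) (p : unitInterval) (q : ℝ) {L R : Finset V} (hL : ∀ ℓ ∈ L, ℓ ≠ u ∧ ℓ ≠ v) (hRL : R ⊆ L)
    {ω : BondConfig V} (hω : rcWeightW (wK u v p L) q ∅ ω ≠ 0) :
    ω ∈ clusterIn u {S : Set V | v ∈ S ∧ ∀ ℓ ∈ R, ℓ ∈ S} ↔ ω ∈ ev u v R := by
  have hapex : ∀ ℓ ∈ L, ∀ e ∈ ω, ℓ ∈ e → e = s(u, ℓ) ∨ e = s(ℓ, v) := fun ℓ hℓ =>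
    apex_of_rcWeightW_ne_zero _ q (hL ℓ hℓ).1 (hL ℓ hℓ).2 (apex_hyp u v p L ℓ) hω
  change (v ∈ openCluster ω u ∧ ∀ ℓ ∈ R, ℓ ∈ openCluster ω u) ↔
    ω ∈ (openConn u v : Set (BondConfig V)) ∧ ∀ ℓ ∈ R, s(u, ℓ) ∈ ω ∨ s(ℓ, v) ∈ ω
  rw [mem_openConn_iff']
  constructor
  · rintro ⟨huv', hR⟩
    refine ⟨huv', fun ℓ hℓ => ?_⟩
    have hr : (openGraph ω).Reachable u ℓ := hR ℓ hℓ
    rw [reachable_ux_apex_iff (hL ℓ (hRL hℓ)).1 (hL ℓ (hRL hℓ)).2 (hapex ℓ (hRL hℓ))] at hr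
    rcases hr with h | ⟨h, -⟩
    · exact Or.inl h
    · exact Or.inr h
  · rintro ⟨huv', hR⟩
    refine ⟨huv', fun ℓ hℓ => ?_⟩
    rcases hR ℓ hℓ with h | h
    · have hadj : (openGraph ω).Adj u ℓ := by rw [openGraph_adj]; exact ⟨h, (hL ℓ (hRL hℓ)).1.symm⟩
      exact hadj.reachable
    · have hadj : (openGraph ω).Adj v ℓ := by
        rw [openGraph_adj, Sym2.eq_swap]; exact ⟨h, (hL ℓ (hRL hℓ)).2.symm⟩
      exact huv'.trans hadj.reachable

omit [Fintype V] in
/-- The principal filter `{S ⊇ R ∪ {v}}` is an up-set. [folklore] -/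
theorem isUpperSet_principal (v : V) (R : Finset V) : IsUpperSet {S : Set V | v ∈ S ∧ ∀ ℓ ∈ R, ℓ ∈ S} :=
  fun _ _ hST h => ⟨hST h.1, fun ℓ hℓ => hST (h.2 ℓ hℓ)⟩

/-! ### The witness `K_{2,34} ⊆ Fin 36` -/

/-- The parameter `1/3`. [folklore] -/
def pThird : unitInterval := ⟨1 / 3, by norm_num, by norm_num⟩

/-- The leaves `2, …, 35`. [folklore] -/
def leaves : Finset (Fin 36) := Finset.univ.filter fun i => 2 ≤ i.val

/-- `R = {2, …, 18}`. [folklore] -/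
def halfR : Finset (Fin 36) := Finset.univ.filter fun i => 2 ≤ i.val ∧ i.val ≤ 18

/-- `R' = {19, …, 35}`. [folklore] -/
def halfR' : Finset (Fin 36) := Finset.univ.filter fun i => 19 ≤ i.val

/-- **CA fails on `Fin 36` at `q = 1/4`**: the double cone `K_{2,34}` with `p = 1/3`, root the hub `0`, and the principal up-sets of
`{1} ∪ {2..18}` and `{1} ∪ {19..35}`. [cite: Grimmett2006, §3.9 (p. 63)] [cite: AyyerLinussonRavichandran2025, §7 Conj. 7.1 (p. 22)] -/
theorem not_clusterAssocOn_fin36 : ¬ ClusterAssocOn (Fin 36) (1 / 4 : ℝ) := by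
  intro h
  have hq : (1 / 4 : ℝ) ≠ 0 := by norm_num
  have hq0 : (0 : ℝ) < 1 / 4 := by norm_num
  have hqq : (1 / 4 : ℝ) = ((1 / 4 : ℚ) : ℝ) := by norm_num
  have hpq : ((pThird : unitInterval) : ℝ) = ((1 / 3 : ℚ) : ℝ) := by simp [pThird]
  have huv : (0 : Fin 36) ≠ 1 := by decide
  have hL : ∀ ℓ ∈ leaves, ℓ ≠ (0 : Fin 36) ∧ ℓ ≠ 1 := by decide
  have hR : halfR ⊆ leaves := by decide
  have hR' : halfR' ⊆ leaves := by decide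
  have hRR' : halfR ∪ halfR' = leaves := by decide
  have hcL : leaves.card = 34 := by decide
  have hcR : halfR.card = 17 := by decide
  have hcR' : halfR'.card = 17 := by decide
  set w := wK (0 : Fin 36) 1 pThird leaves with hw
  have key := h w 0 _ _ (isUpperSet_principal (1 : Fin 36) halfR) (isUpperSet_principal (1 : Fin 36) halfR')
  have hZ := rcPartitionFunctionW_pos w hq0 (∅ : Set (Fin 36))
  -- the three masses
  have hU : (rcMeasureW w (1 / 4) ∅).real (clusterIn 0 {S : Set (Fin 36) | (1 : Fin 36) ∈ S ∧ ∀ ℓ ∈ halfR, ℓ ∈ S}) =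
      ((Nr (1 / 3) (1 / 4) 36 17 34 : ℚ) : ℝ) / rcPartitionFunctionW w (1 / 4) ∅ := by
    rw [rcMeasureW_real_eq_sum_div w hq0, sum_rcWeightW_ind_congr_ae w (1 / 4)
      (fun ω hω => clusterIn_iff_ev 0 1 pThird (1 / 4) hL hR hω),
      N_eq 0 1 pThird (1 / 4) (1 / 3) (1 / 4) hq hqq hpq huv halfR leaves hL hR, hcR, hcL, Fintype.card_fin]
  have hU' : (rcMeasureW w (1 / 4) ∅).real (clusterIn 0 {S : Set (Fin 36) | (1 : Fin 36) ∈ S ∧ ∀ ℓ ∈ halfR', ℓ ∈ S}) =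
      ((Nr (1 / 3) (1 / 4) 36 17 34 : ℚ) : ℝ) / rcPartitionFunctionW w (1 / 4) ∅ := by
    rw [rcMeasureW_real_eq_sum_div w hq0, sum_rcWeightW_ind_congr_ae w (1 / 4)
      (fun ω hω => clusterIn_iff_ev 0 1 pThird (1 / 4) hL hR' hω),
      N_eq 0 1 pThird (1 / 4) (1 / 3) (1 / 4) hq hqq hpq huv halfR' leaves hL hR', hcR', hcL, Fintype.card_fin]
  have hinter : clusterIn (0 : Fin 36) {S : Set (Fin 36) | (1 : Fin 36) ∈ S ∧ ∀ ℓ ∈ halfR, ℓ ∈ S} ∩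
      clusterIn 0 {S : Set (Fin 36) | (1 : Fin 36) ∈ S ∧ ∀ ℓ ∈ halfR', ℓ ∈ S} =
      clusterIn 0 {S : Set (Fin 36) | (1 : Fin 36) ∈ S ∧ ∀ ℓ ∈ leaves, ℓ ∈ S} := by
    ext ω
    simp only [clusterIn, Set.mem_inter_iff, Set.mem_setOf_eq, ← hRR', Finset.mem_union]
    constructor
    · rintro ⟨⟨h1, h2⟩, ⟨-, h3⟩⟩
      exact ⟨h1, fun ℓ hℓ => hℓ.elim (h2 ℓ) (h3 ℓ)⟩
    · rintro ⟨h1, h2⟩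
      exact ⟨⟨h1, fun ℓ hℓ => h2 ℓ (Or.inl hℓ)⟩, ⟨h1, fun ℓ hℓ => h2 ℓ (Or.inr hℓ)⟩⟩
  have hUV : (rcMeasureW w (1 / 4) ∅).real (clusterIn (0 : Fin 36) {S : Set (Fin 36) | (1 : Fin 36) ∈ S ∧ ∀ ℓ ∈ halfR, ℓ ∈ S} ∩
      clusterIn 0 {S : Set (Fin 36) | (1 : Fin 36) ∈ S ∧ ∀ ℓ ∈ halfR', ℓ ∈ S}) =
      ((Nr (1 / 3) (1 / 4) 36 34 34 : ℚ) : ℝ) / rcPartitionFunctionW w (1 / 4) ∅ := by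
    rw [hinter, rcMeasureW_real_eq_sum_div w hq0, sum_rcWeightW_ind_congr_ae w (1 / 4)
      (fun ω hω => clusterIn_iff_ev 0 1 pThird (1 / 4) hL subset_rfl hω),
      N_eq 0 1 pThird (1 / 4) (1 / 3) (1 / 4) hq hqq hpq huv leaves leaves hL subset_rfl, hcL, Fintype.card_fin]
  have hZv : rcPartitionFunctionW w (1 / 4) ∅ = ((ZM (1 / 3) (1 / 4) 36 34).1 : ℝ) := by
    rw [(ZM_eq 0 1 pThird (1 / 4) (1 / 3) (1 / 4) hq hqq hpq huv leaves hL).1, hcL, Fintype.card_fin]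
  rw [hU, hU', hUV, div_mul_div_comm,
    ← mul_div_mul_right (((Nr (1 / 3) (1 / 4) 36 34 34 : ℚ) : ℝ)) _ hZ.ne',
    div_le_div_iff_of_pos_right (mul_pos hZ hZ), hZv] at key
  have cert := certificate
  have cert' : ((Nr (1 / 3) (1 / 4) 36 34 34 * (ZM (1 / 3) (1 / 4) 36 34).1 : ℚ) : ℝ) <
      ((Nr (1 / 3) (1 / 4) 36 17 34 * Nr (1 / 3) (1 / 4) 36 17 34 : ℚ) : ℝ) := by exact_mod_cast cert
  push_cast at cert'
  linarith

end ClusterAssocCex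

/-- **CA (`ClusterAssocFKPos`, fk-1 g7) is FALSE**: the law of the cluster of a vertex under `φ_{w,q}`, `q = 1/4`, is not positively
associated (witness `K_{2,34}`, `p = 1/3`).  Refuted-substantive for the node as filed (`∀ q > 0`); CA holds for `q ≥ 1`
(`clusterAssocOn_of_one_le`). [cite: AyyerLinussonRavichandran2025, §7 eq. (13), Conj. 7.1 (p. 22)] [cite: Grimmett2006, §3.9 (p. 63)] -/
theorem not_clusterAssocFKPos : ¬ ClusterAssocFKPos := fun h =>
  ClusterAssocCex.not_clusterAssocOn_fin36 (h (1 / 4) (by norm_num) 36)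

/-- **RB (`ClusterPairCountAll`, fk-1 g7's `q`-free fiber-counting form of CA) is FALSE as filed**, since it implies CA
(`clusterAssocFKPos_of_clusterPairCountAll`): some fiber of `K_{36}` violates the counting criterion.  (Census gen 18: RB is TRUE on
every vertex type with `≤ 7` elements — `ClusterPairCountOn (Fin n)`, `n ≤ 7`, decided exhaustively; the failure is a large-graph
phenomenon.) [cite: Wagner2006, Conj. 5.3 (p. 13)] [cite: AyyerLinussonRavichandran2025, §7 eq. (13), Conj. 7.1 (p. 22)] -/
theorem not_clusterPairCountAll : ¬ ClusterPairCountAll := fun h =>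
  not_clusterAssocFKPos (clusterAssocFKPos_of_clusterPairCountAll h)

end FK

end Summit.CriticalPhenomena.PercolationContinuityZ3.Theorems

end
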